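import Summits.ResolutionOfSingularities.ResolutionOfSingularities.Theorems.HilbertSamuelEliminationCampaignW42RidgeConeNear
import Summits.ResolutionOfSingularities.ResolutionOfSingularities.Theorems.HilbertSamuelEliminationCampaignW42ChartFibre
import Literature.AlgebraicGeometry.Resolution.RidgeCone
import HarnessLib

/-!
# [OURS · L1 W4.2] Ridge confinement for the blow-up of the VERTEX of an arbitrary cone, at rational
# points of the exceptional divisor: `x'` near ⟺ its direction lies in Giraud's ridge (campaign s42 of
# cell res-hironaka, LADDER-RESOLUTION rung L; informal crux `RidgeConfinement`,
# stmt-ResolutionOfSingularities-17845; `--supports`)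

HONEST FRAMING. OURS (slot W4.2, prover res-L1-s42-pv-1, gen 2): the model case `X = C_x(X)` (a cone),
`D = {vertex}` of the repaired obstruction O1, for ARBITRARY homogeneous ideals (the gen-0 file
`…CampaignW42RidgeConfinementHypersurface.lean` treats hypersurfaces, for arbitrary coordinate centres),
at `K`-RATIONAL points of the exceptional divisor, in the affine charts of the blow-up. Classical
mathematics (Hironaka 1970, Giraud 1975 §1.5, CJS 2020 Thm. 3.10 / Def. 3.13 / Rem. 18.29) read in the
chart model; NOTHING here is a statement of H. Hironaka's manuscript [Hironaka2017]. AI review is weaker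
than expert review.

## The model and the results

`S = K[X_1, …, X_n]`, `I ⊆ S` homogeneous, `C = V(I)`, `π : Bl_0 𝔸ⁿ → 𝔸ⁿ` the blow-up of the origin; its
`j`-th chart is the tree's substitution `φ_j = Resolution.coordBlowupSubst K univ j` (`X_i ↦ X_j X_i` for
`i ≠ j`); `φ_j(f) = X_j^d · f(X_j := 1)` for a form of degree `d` (`coordBlowupSubst_univ_eq_of_isHomogeneous`),
so the STRICT TRANSFORM `C'_j` is cut out by `J = ⟨f(X_j := 1) : f ∈ I⟩ = I.map (CampaignW42.dehomog K j)`,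
the exceptional divisor is `{X_j = 0}`, and a `K`-rational point `x'` of `C'_j ∩ {X_j = 0}` is a vector
`b ∈ Kⁿ` with `b_j = 0`, of direction `b + e_j ∈ C(K)`.

* `map_shift_add_single_dehomog`, `finrank_quotient_strictTransform_add_single_eq` — `J` is invariant
  under translations along `X_j`, so the Hilbert–Samuel numbers of `C'_j` at `b` and `b + e_j` agree;
* `nonempty_algEquiv_quotient_strictTransform`, `finrank_quotient_strictTransform_eq_of_apply_eq_one` —
  **off `{X_j = 0}` the chart is an isomorphism onto the cone**: `S/(I + 𝔪_w^N) ≅ S/(J + 𝔪_w^N)` for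
  `w_j = 1` (inverse `X_i ↦ X_i X_j⁻¹`; `X_j ≡ 1` is a unit modulo `𝔪_w^N`);
* **`finrank_quotient_strictTransform_eq_cone`**: `dim_K S/(J + 𝔪_b^{d+1}) = dim_K S/(I + 𝔪_{b+e_j}^{d+1})`;
  **`finrank_quotient_strictTransform_le`**: `H⁽¹⁾_{C'}(x') ≤ H⁽¹⁾_C(0)` (CJS Thm. 3.10 (1) in the model);
* **`add_single_mem_ridge_iff_near`** — THE CONFINEMENT: `x'` is near (no drop of the Hilbert–Samuel
  numbers) iff `b + e_j ∈ F(C)(K)` (`Literature.AlgebraicGeometry.Resolution.ridge`): **the near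
  `K`-rational points of `π⁻¹(0) ∩ C'` are exactly the `K`-points of `ℙ(F(C))`**, every cone, field and
  characteristic; `add_single_mem_ridge_of_finrank_le` (near ⟹ in the ridge).

Not here: the identification of `S/J` with the tree's `Proj` blow-up charts (`IsBlowup`), non-rational
points, centres of positive dimension.

References (orientation only): H. Hironaka, Ann. of Math. 92 (1970); J. Giraud, Ann. Sci. ÉNS 8 (1975)
§1.5; V. Cossart, U. Jannsen, S. Saito, LNM 2270 (2020), Thm. 3.10, Def. 3.13, Thm. 3.14, Rem. 18.29;
J. Berthomieu, P. Hivert, H. Mourtada, Contemp. Math. 521 (2010), Introduction.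
-/

noncomputable section

-- single-conjunct summit: the doubled namespace component `ResolutionOfSingularities` is mandated
set_option linter.dupNamespace false

open MvPolynomial Module IsLocalRing
open Literature.RingTheory.MvPolynomial (shift shift_X shift_shift shift_zero shift_injective eval_shift)
open Literature.RingTheory.HilbertSamuel
open Literature.AlgebraicGeometry.Resolution

namespace Summit.ResolutionOfSingularities.ResolutionOfSingularities.Theorems

namespace CampaignW42

universe u

variable {K : Type u} [Field K] {n : ℕ}

/-! ## The strict transform `J = ⟨f(X_j := 1) : f ∈ I⟩` is invariant under translations along `X_j` -/

/-- `f(X_j := 1)` does not involve `X_j`: it is fixed by the translations `X_j ↦ X_j + c`. [folklore] -/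
theorem shift_single_dehomog (j : Fin n) (c : K) (f : MvPolynomial (Fin n) K) :
    shift (Pi.single j c) (dehomog K j f) = dehomog K j f := by
  have h : (shift (Pi.single j c)).comp (dehomog K j) = dehomog K j := by
    refine MvPolynomial.algHom_ext fun i => ?_
    rw [AlgHom.comp_apply, dehomog_X]
    split_ifs with hij
    · rw [map_one]
    · rw [shift_X, Pi.single_eq_of_ne hij, C_0, add_zero]
  exact AlgHom.congr_fun h f

/-- `τ_{c e_j} J ⊆ J` for `J = I.map (dehomog K j)` and every `c`. [folklore] -/
theorem shift_single_mem_map_dehomog {I : Ideal (MvPolynomial (Fin n) K)} (j : Fin n) (c : K)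
    {g : MvPolynomial (Fin n) K} (hg : g ∈ I.map (dehomog K j)) :
    shift (Pi.single j c) g ∈ I.map (dehomog K j) := by
  have hle : (I.map (dehomog K j)).map (shift (Pi.single j c)) ≤ I.map (dehomog K j) := by
    rw [Ideal.map_le_iff_le_comap, Ideal.map_le_iff_le_comap]
    intro f hf
    rw [Ideal.mem_comap, Ideal.mem_comap, shift_single_dehomog]
    exact Ideal.mem_map_of_mem _ hf
  exact hle (Ideal.mem_map_of_mem _ hg)

/-- **`τ_{b + c e_j} J = τ_b J`**: translating the strict transform ideal along `X_j` does not change it.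
[folklore] -/
theorem map_shift_add_single_dehomog (I : Ideal (MvPolynomial (Fin n) K)) (j : Fin n) (b : Fin n → K)
    (c : K) :
    (I.map (dehomog K j)).map (shift (b + Pi.single j c)) = (I.map (dehomog K j)).map (shift b) := by
  refine le_antisymm ?_ ?_
  · rw [Ideal.map_le_iff_le_comap]
    intro g hg
    rw [Ideal.mem_comap, ← shift_shift]
    exact Ideal.mem_map_of_mem _ (shift_single_mem_map_dehomog j c hg)
  · rw [Ideal.map_le_iff_le_comap]
    intro g hg
    rw [Ideal.mem_comap]
    have h1 : shift b g = shift (b + Pi.single j c) (shift (Pi.single j (-c)) g) := by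
      rw [shift_shift, add_assoc, ← Pi.single_add, add_neg_cancel, Pi.single_zero, add_zero]
    rw [h1]
    exact Ideal.mem_map_of_mem _ (shift_single_mem_map_dehomog j (-c) hg)

/-- **The Hilbert–Samuel numbers of the strict transform at `b` and at `b + c e_j` agree**
(`C'_j = (C ∩ {X_j = 1}) × 𝔸¹_{X_j}`). [folklore] -/
theorem finrank_quotient_strictTransform_add_single_eq (I : Ideal (MvPolynomial (Fin n) K)) (j : Fin n)
    (b : Fin n → K) (c : K) (N : ℕ) :
    finrank K (MvPolynomial (Fin n) K ⧸ (I.map (dehomog K j) ⊔ RingHom.ker (eval (b + Pi.single j c)) ^ (N + 1))) =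
      finrank K (MvPolynomial (Fin n) K ⧸ (I.map (dehomog K j) ⊔ RingHom.ker (eval b) ^ (N + 1))) := by
  rw [finrank_quotient_sup_ker_eval_pow_eq, finrank_quotient_sup_ker_eval_pow_eq,
    map_shift_add_single_dehomog]

/-! ## Off the exceptional divisor the chart is an isomorphism onto the cone -/

/-- **`φ_j(f) = X_j^d · f(X_j := 1)`** for a form `f` of degree `d` and the blow-up substitution
`φ_j : X_i ↦ X_j X_i` (`i ≠ j`), `X_j ↦ X_j` of the tree (`Resolution.coordBlowupSubst K univ j`).
[folklore] -/
theorem coordBlowupSubst_univ_eq_of_isHomogeneous (j : Fin n) {f : MvPolynomial (Fin n) K} {d : ℕ}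
    (hf : f.IsHomogeneous d) :
    coordBlowupSubst K Set.univ j f = X j ^ d * dehomog K j f := by
  have h1 : coordBlowupSubst K Set.univ j =
      aeval ((X j : MvPolynomial (Fin n) K) • fun i => if i = j then (1 : MvPolynomial (Fin n) K) else X i) := by
    refine MvPolynomial.algHom_ext fun i => ?_
    rw [aeval_X, Pi.smul_apply, smul_eq_mul]
    by_cases hij : i = j
    · subst hij
      rw [coordBlowupSubst_X_self, if_pos rfl, mul_one]
    · rw [coordBlowupSubst_X_of_mem_of_ne K Set.univ j (Set.mem_univ i) hij, if_neg hij]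
  rw [h1, aeval_smul_of_isHomogeneous hf]
  rfl

/-- `φ_j(I) ⊆ J` for a homogeneous ideal `I`. [folklore] -/
theorem map_coordBlowupSubst_le_map_dehomog {I : Ideal (MvPolynomial (Fin n) K)} (hI : IsHomogeneousIdeal I)
    (j : Fin n) : I.map (coordBlowupSubst K Set.univ j) ≤ I.map (dehomog K j) := by
  rw [Ideal.map_le_iff_le_comap]
  intro f hf
  rw [Ideal.mem_comap, ← sum_homogeneousComponent f, map_sum]
  refine Ideal.sum_mem _ fun e _ => ?_
  rw [coordBlowupSubst_univ_eq_of_isHomogeneous j (homogeneousComponent_isHomogeneous e f)]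
  exact Ideal.mul_mem_left _ _ (Ideal.mem_map_of_mem _ (hI f hf e))

/-- `φ_j` fixes the point `w` when `w_j = 1`: `(φ_j f)(w) = f(w)`. [folklore] -/
theorem eval_coordBlowupSubst_of_apply_eq_one (j : Fin n) {w : Fin n → K} (hw : w j = 1)
    (f : MvPolynomial (Fin n) K) : eval w (coordBlowupSubst K Set.univ j f) = eval w f := by
  have h : (aeval w).comp (coordBlowupSubst K Set.univ j) = aeval w := by
    refine MvPolynomial.algHom_ext fun i => ?_
    rw [AlgHom.comp_apply, aeval_X]
    by_cases hij : i = j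
    · subst hij
      rw [coordBlowupSubst_X_self, aeval_X]
    · rw [coordBlowupSubst_X_of_mem_of_ne K Set.univ j (Set.mem_univ i) hij, map_mul, aeval_X, aeval_X,
        hw, one_mul]
  have := AlgHom.congr_fun h f
  rw [AlgHom.comp_apply] at this
  exact this

/-- `𝔪_w = ⟨X_i − w_i⟩`: the ideal of a rational point is generated by the linear forms `X_i − w_i`
(via the translation `τ_{-w}` of `𝔪 = (X_1, …, X_n)`). [folklore] -/
theorem ker_eval_eq_span (w : Fin n → K) :
    RingHom.ker (eval w) = Ideal.span (Set.range fun i => (X i - C (w i) : MvPolynomial (Fin n) K)) := by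
  refine le_antisymm ?_ ?_
  · intro f hf
    rw [RingHom.mem_ker] at hf
    have hg : shift w f ∈ idealOfVars (Fin n) K := by
      rw [← ker_eval_zero, RingHom.mem_ker, eval_shift, zero_add]
      exact hf
    have hf' : f = shift (-w) (shift w f) := by rw [shift_shift, neg_add_cancel, shift_zero]
    have hrange : (Set.range fun i => (X i - C (w i) : MvPolynomial (Fin n) K)) =
        (shift (-w)) '' Set.range (X : Fin n → MvPolynomial (Fin n) K) := by
      rw [← Set.range_comp]
      refine congrArg Set.range (funext fun i => ?_)
      rw [Function.comp_apply, shift_X, Pi.neg_apply, map_neg, sub_eq_add_neg]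
    rw [hrange, ← Ideal.map_span, hf']
    exact Ideal.mem_map_of_mem _ hg
  · rw [Ideal.span_le]
    rintro _ ⟨i, rfl⟩
    rw [SetLike.mem_coe, RingHom.mem_ker, map_sub, eval_X, eval_C, sub_self]

section Chart

variable {I : Ideal (MvPolynomial (Fin n) K)} (hI : IsHomogeneousIdeal I) (j : Fin n) {w : Fin n → K}
  (hw : w j = 1) (N : ℕ)

include hI hw in
/-- `φ_j(I + 𝔪_w^N) ⊆ J + 𝔪_w^N`. [folklore] -/
theorem sup_pow_le_comap_coordBlowupSubst :
    I ⊔ RingHom.ker (eval w) ^ N ≤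
      (I.map (dehomog K j) ⊔ RingHom.ker (eval w) ^ N).comap (coordBlowupSubst K Set.univ j) := by
  rw [← Ideal.map_le_iff_le_comap, Ideal.map_sup, Ideal.map_pow]
  refine sup_le_sup (map_coordBlowupSubst_le_map_dehomog hI j) (Ideal.pow_right_mono ?_ N)
  rw [Ideal.map_le_iff_le_comap]
  intro f hf
  rw [Ideal.mem_comap, RingHom.mem_ker, eval_coordBlowupSubst_of_apply_eq_one j hw]
  exact hf

include hI hw in
/-- **Off the exceptional divisor the chart is an isomorphism onto the cone**: for `w ∈ Kⁿ` with
`w_j = 1`, `S/(I + 𝔪_w^N) ≅ S/(J + 𝔪_w^N)` as `K`-algebras, `J = I.map (dehomog K j)` the strict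
transform ideal — induced by `φ_j`, with inverse `X_i ↦ X_i · X_j⁻¹` (`X_j ≡ 1` is a unit modulo
`𝔪_w^N`), using `f(X_j⁻¹ · x) = X_j^{-d} f(x)` for the forms `f ∈ I`. [folklore] -/
theorem nonempty_algEquiv_quotient_strictTransform :
    Nonempty ((MvPolynomial (Fin n) K ⧸ (I ⊔ RingHom.ker (eval w) ^ N)) ≃ₐ[K]
      (MvPolynomial (Fin n) K ⧸ (I.map (dehomog K j) ⊔ RingHom.ker (eval w) ^ N))) := by
  set 𝔪 : Ideal (MvPolynomial (Fin n) K) := RingHom.ker (eval w) with h𝔪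
  set P : Ideal (MvPolynomial (Fin n) K) := I ⊔ 𝔪 ^ N with hP
  set P' : Ideal (MvPolynomial (Fin n) K) := I.map (dehomog K j) ⊔ 𝔪 ^ N with hP'
  -- the forward map `φ`
  let φ : (MvPolynomial (Fin n) K ⧸ P) →ₐ[K] (MvPolynomial (Fin n) K ⧸ P') :=
    Ideal.quotientMapₐ P' (coordBlowupSubst K Set.univ j) (sup_pow_le_comap_coordBlowupSubst hI j hw N)
  have hφ : ∀ f, φ (Ideal.Quotient.mk P f) = Ideal.Quotient.mk P' (coordBlowupSubst K Set.univ j f) :=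
    fun f => rfl
  -- `X_j` is a unit modulo `𝔪_w^N`
  have hXj : (X j - C 1 : MvPolynomial (Fin n) K) ∈ 𝔪 := by
    rw [h𝔪, RingHom.mem_ker, map_sub, eval_X, eval_C, hw, sub_self]
  have hgen : ∀ i, (X i - C (w i) : MvPolynomial (Fin n) K) ∈ 𝔪 := fun i => by
    rw [h𝔪, RingHom.mem_ker, map_sub, eval_X, eval_C, sub_self]
  have hunit : ∀ Q : Ideal (MvPolynomial (Fin n) K), 𝔪 ^ N ≤ Q → IsUnit (Ideal.Quotient.mk Q (X j)) := by
    intro Q hQ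
    have hnil : IsNilpotent (Ideal.Quotient.mk Q (X j) - 1) := by
      refine ⟨N, ?_⟩
      rw [show (Ideal.Quotient.mk Q (X j) - 1 : MvPolynomial (Fin n) K ⧸ Q) = Ideal.Quotient.mk Q (X j - C 1) by
        rw [map_sub, C_1, map_one], ← map_pow, Ideal.Quotient.eq_zero_iff_mem]
      exact hQ (Ideal.pow_mem_pow hXj N)
    have h := hnil.isUnit_add_one
    rwa [sub_add_cancel] at h
  obtain ⟨u, hu⟩ := hunit P le_sup_right
  -- the backward map `ψ₀ : S → S/P`
  let ψ₀ : MvPolynomial (Fin n) K →ₐ[K] (MvPolynomial (Fin n) K ⧸ P) :=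
    aeval fun i => if i = j then (u : MvPolynomial (Fin n) K ⧸ P) else ↑u⁻¹ * Ideal.Quotient.mk P (X i)
  have hψ₀X : ∀ i, ψ₀ (X i) =
      if i = j then (u : MvPolynomial (Fin n) K ⧸ P) else ↑u⁻¹ * Ideal.Quotient.mk P (X i) :=
    fun i => aeval_X _ i
  have hψ₀C : ∀ c : K, ψ₀ (C c) = Ideal.Quotient.mk P (C c) := fun c => by
    rw [algHom_C, ← MvPolynomial.algebraMap_eq, Ideal.Quotient.mk_algebraMap]
  -- `ψ₀` kills `J`
  have hψJ : ∀ f ∈ I, ψ₀ (dehomog K j f) = 0 := by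
    intro f hf
    have hcomp : ψ₀.comp (dehomog K j) =
        aeval ((↑u⁻¹ : MvPolynomial (Fin n) K ⧸ P) • fun i => Ideal.Quotient.mk P (X i)) := by
      refine MvPolynomial.algHom_ext fun i => ?_
      rw [AlgHom.comp_apply, dehomog_X, aeval_X, Pi.smul_apply, smul_eq_mul]
      split_ifs with hij
      · subst hij
        rw [map_one, ← hu, Units.inv_mul]
      · rw [hψ₀X, if_neg hij]
    have h2 : ∀ e, aeval (fun i => Ideal.Quotient.mk P (X i : MvPolynomial (Fin n) K))
        (homogeneousComponent e f) = Ideal.Quotient.mk P (homogeneousComponent e f) := by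
      intro e
      have h3 : (Ideal.Quotient.mkₐ K P).comp (aeval X) =
          aeval fun i => Ideal.Quotient.mk P (X i : MvPolynomial (Fin n) K) := comp_aeval _ _
      rw [← h3, aeval_X_left]
      rfl
    rw [← AlgHom.comp_apply, hcomp, ← sum_homogeneousComponent f, map_sum]
    refine Finset.sum_eq_zero fun e _ => ?_
    rw [aeval_smul_of_isHomogeneous (homogeneousComponent_isHomogeneous e f), h2,
      Ideal.Quotient.eq_zero_iff_mem.mpr (Ideal.mem_sup_left (hI f hf e)), mul_zero]
  -- `ψ₀` maps `𝔪_w` into `𝔪_w/P`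
  have hψm : 𝔪 ≤ (𝔪.map (Ideal.Quotient.mk P)).comap ψ₀ := by
    have hb : ∀ i, Ideal.Quotient.mk P (X i - C (w i)) ∈ 𝔪.map (Ideal.Quotient.mk P) :=
      fun i => Ideal.mem_map_of_mem _ (hgen i)
    rw [h𝔪, ker_eval_eq_span w, Ideal.span_le]
    rintro _ ⟨i, rfl⟩
    rw [SetLike.mem_coe, Ideal.mem_comap, ← ker_eval_eq_span w, map_sub, hψ₀X, hψ₀C]
    by_cases hij : i = j
    · subst hij
      rw [if_pos rfl, hu, ← map_sub]
      exact hb _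
    · rw [if_neg hij]
      have key : (↑u⁻¹ * Ideal.Quotient.mk P (X i) - Ideal.Quotient.mk P (C (w i)) :
          MvPolynomial (Fin n) K ⧸ P) =
          ↑u⁻¹ * (Ideal.Quotient.mk P (X i - C (w i)) -
            Ideal.Quotient.mk P (C (w i)) * Ideal.Quotient.mk P (X j - C 1)) := by
        have h1 : (↑u⁻¹ : MvPolynomial (Fin n) K ⧸ P) * ↑u = 1 := Units.inv_mul u
        rw [hu] at h1
        simp only [map_sub, map_one]
        linear_combination (Ideal.Quotient.mk P (C (w i))) * h1
      rw [key]
      refine Ideal.mul_mem_left _ _ (Ideal.sub_mem _ (hb i) (Ideal.mul_mem_left _ _ ?_))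
      have := hb j
      rwa [hw] at this
  -- `ψ₀` kills `P'`
  have hψP' : ∀ a ∈ P', ψ₀ a = 0 := by
    have hle : P' ≤ RingHom.ker (ψ₀ : MvPolynomial (Fin n) K →+* MvPolynomial (Fin n) K ⧸ P) := by
      refine sup_le ?_ ?_
      · rw [Ideal.map_le_iff_le_comap]
        intro f hf
        exact hψJ f hf
      · intro a ha
        have h1 : ψ₀ a ∈ (𝔪 ^ N).map (ψ₀ : MvPolynomial (Fin n) K →+* MvPolynomial (Fin n) K ⧸ P) :=
          Ideal.mem_map_of_mem _ ha
        rw [Ideal.map_pow] at h1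
        have h2 : 𝔪.map (ψ₀ : MvPolynomial (Fin n) K →+* MvPolynomial (Fin n) K ⧸ P) ≤
            𝔪.map (Ideal.Quotient.mk P) := Ideal.map_le_iff_le_comap.mpr hψm
        have h3 := Ideal.pow_right_mono h2 N h1
        rw [← Ideal.map_pow, (Ideal.map_eq_bot_iff_le_ker _).mpr (by rw [Ideal.mk_ker]; exact le_sup_right)] at h3
        exact h3
    exact fun a ha => hle ha
  let ψ : (MvPolynomial (Fin n) K ⧸ P') →ₐ[K] (MvPolynomial (Fin n) K ⧸ P) := Ideal.Quotient.liftₐ P' ψ₀ hψP'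
  have hψ : ∀ f, ψ (Ideal.Quotient.mk P' f) = ψ₀ f := fun f => rfl
  -- the two compositions
  have h1 : ψ.comp φ = AlgHom.id K _ := by
    refine Ideal.Quotient.algHom_ext K (MvPolynomial.algHom_ext fun i => ?_)
    rw [AlgHom.comp_apply, AlgHom.comp_apply, AlgHom.comp_apply, AlgHom.id_apply, Ideal.Quotient.mkₐ_eq_mk,
      hφ, hψ]
    by_cases hij : i = j
    · subst hij
      rw [coordBlowupSubst_X_self, hψ₀X, if_pos rfl, hu]
    · rw [coordBlowupSubst_X_of_mem_of_ne K Set.univ j (Set.mem_univ i) hij, map_mul, hψ₀X, if_pos rfl,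
        hψ₀X, if_neg hij, Units.mul_inv_cancel_left]
  have h2 : φ.comp ψ = AlgHom.id K _ := by
    refine Ideal.Quotient.algHom_ext K (MvPolynomial.algHom_ext fun i => ?_)
    rw [AlgHom.comp_apply, AlgHom.comp_apply, AlgHom.comp_apply, AlgHom.id_apply, Ideal.Quotient.mkₐ_eq_mk,
      hψ, hψ₀X]
    have hφu : φ (u : MvPolynomial (Fin n) K ⧸ P) = Ideal.Quotient.mk P' (X j) := by
      rw [hu, hφ, coordBlowupSubst_X_self]
    by_cases hij : i = j
    · subst hij
      rw [if_pos rfl, hφu]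
    · rw [if_neg hij, map_mul, hφ, coordBlowupSubst_X_of_mem_of_ne K Set.univ j (Set.mem_univ i) hij,
        map_mul, ← hφu, ← mul_assoc, ← map_mul, Units.inv_mul, map_one, one_mul]
  exact ⟨AlgEquiv.ofAlgHom φ ψ h2 h1⟩

include hI hw in
/-- **`dim_K S/(J + 𝔪_w^N) = dim_K S/(I + 𝔪_w^N)` for `w_j = 1`**: the Hilbert–Samuel numbers of the
strict transform at a rational point off the exceptional divisor are those of the cone at the
corresponding point. [folklore] -/
theorem finrank_quotient_strictTransform_eq_of_apply_eq_one :
    finrank K (MvPolynomial (Fin n) K ⧸ (I.map (dehomog K j) ⊔ RingHom.ker (eval w) ^ N)) =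
      finrank K (MvPolynomial (Fin n) K ⧸ (I ⊔ RingHom.ker (eval w) ^ N)) := by
  obtain ⟨e⟩ := nonempty_algEquiv_quotient_strictTransform hI j hw N
  exact e.toLinearEquiv.finrank_eq.symm

end Chart

/-! ## Near rational points of the exceptional divisor are the rational points of `ℙ(F(C))` -/

section Exceptional

variable {I : Ideal (MvPolynomial (Fin n) K)} (hI : IsHomogeneousIdeal I) (j : Fin n) {b : Fin n → K}
  (hb : b j = 0)

include hI hb in
/-- **The Hilbert–Samuel numbers of the strict transform `C'_j` at the rational point `b` (`b_j = 0`) of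
the exceptional divisor are those of the cone `C` at its rational point `b + e_j`** (the direction of
`x' = b`): `dim_K S/(J + 𝔪_b^{d+1}) = dim_K S/(I + 𝔪_{b+e_j}^{d+1})`. [folklore] -/
theorem finrank_quotient_strictTransform_eq_cone (d : ℕ) :
    finrank K (MvPolynomial (Fin n) K ⧸ (I.map (dehomog K j) ⊔ RingHom.ker (eval b) ^ (d + 1))) =
      finrank K (MvPolynomial (Fin n) K ⧸ (I ⊔ RingHom.ker (eval (b + Pi.single j 1)) ^ (d + 1))) := by
  have hw : (b + (Pi.single j 1 : Fin n → K)) j = 1 := by rw [Pi.add_apply, hb, Pi.single_eq_same, zero_add]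
  rw [← finrank_quotient_strictTransform_add_single_eq I j b 1 d,
    finrank_quotient_strictTransform_eq_of_apply_eq_one hI j hw (d + 1)]

include hI hb in
/-- **CJS Thm. 3.10 (1) for the blow-up of the vertex of a cone, at rational points:
`H⁽¹⁾_{C'}(x') ≤ H⁽¹⁾_C(0)`** — `dim_K S/(J + 𝔪_b^{d+1}) ≤ dim_K S/(I + 𝔪^{d+1})` for every `d`
(Bennett–Hironaka–Singh; here an elementary consequence of semicontinuity along the cone).
[cite: CossartJannsenSaito2020, Thm. 3.10 (1)] -/
theorem finrank_quotient_strictTransform_le (d : ℕ) :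
    finrank K (MvPolynomial (Fin n) K ⧸ (I.map (dehomog K j) ⊔ RingHom.ker (eval b) ^ (d + 1))) ≤
      finrank K (MvPolynomial (Fin n) K ⧸ (I ⊔ idealOfVars (Fin n) K ^ (d + 1))) := by
  rw [finrank_quotient_strictTransform_eq_cone hI j hb d]
  exact finrank_quotient_sup_ker_eval_pow_le hI _ d

include hI hb in
/-- **RIDGE CONFINEMENT for the blow-up of the vertex of an arbitrary cone, rational points** (Hironaka
1970; Giraud 1975 §1.5; CJS Rem. 18.29 with the ridge in place of the directrix): the `K`-rational point
`x' = b` (`b_j = 0`) of the exceptional divisor of `Bl_0 C` in the chart `j` is NEAR — its Hilbert–Samuel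
numbers `dim_K S/(J + 𝔪_b^{d+1})` do not drop below those of the vertex of `C` — iff its direction `b + e_j`
lies in Giraud's ridge `F(C)(K)`, i.e. iff `x' ∈ ℙ(F(C))(K)`. [cite: Giraud1975, §1.5] -/
theorem add_single_mem_ridge_iff_near :
    b + Pi.single j 1 ∈ ridge K I ↔
      ∀ d : ℕ, finrank K (MvPolynomial (Fin n) K ⧸ (I.map (dehomog K j) ⊔ RingHom.ker (eval b) ^ (d + 1))) =
        finrank K (MvPolynomial (Fin n) K ⧸ (I ⊔ idealOfVars (Fin n) K ^ (d + 1))) := by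
  rw [mem_ridge_iff_finrank_quotient_ker_eval_eq hI]
  refine forall_congr' fun d => ?_
  rw [finrank_quotient_strictTransform_eq_cone hI j hb d]

include hI hb in
/-- **Near ⟹ in the ridge**: if `dim_K S/(I + 𝔪^{d+1}) ≤ dim_K S/(J + 𝔪_b^{d+1})` for all `d` (no drop of
the Hilbert–Samuel function at the rational point `x' = b` of the exceptional divisor), then
`b + e_j ∈ F(C)(K)`. [cite: Giraud1975, §1.5] -/
theorem add_single_mem_ridge_of_finrank_le
    (h : ∀ d : ℕ, finrank K (MvPolynomial (Fin n) K ⧸ (I ⊔ idealOfVars (Fin n) K ^ (d + 1))) ≤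
      finrank K (MvPolynomial (Fin n) K ⧸ (I.map (dehomog K j) ⊔ RingHom.ker (eval b) ^ (d + 1)))) :
    b + Pi.single j 1 ∈ ridge K I :=
  mem_ridge_of_finrank_quotient_ker_eval_le hI _ fun d =>
    (h d).trans_eq (finrank_quotient_strictTransform_eq_cone hI j hb d)

end Exceptional

end CampaignW42

end Summit.ResolutionOfSingularities.ResolutionOfSingularities.Theorems
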